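import Summits.HodgeConjecture.HodgeConjecture.Theorems.F0P3CotangentFormL2Span
import Summits.HodgeConjecture.HodgeConjecture.Theorems.F0P3ValueMapOfFrameVectors
import Summits.HodgeConjecture.HodgeConjecture.Theorems.F0P3HolProjectionReduction
import HarnessLib

/-!
# FLOOR-0 P3 — rung-1 brick B1′: the VALUE MAP OF A HOLOMORPHIC COTANGENT FORM in the archimedean `(𝔤, K)`-module
# `P.archModuleCM` of a discrete automorphic representation `P` of the CM unitary group (J1-free adapter)

Cell hodgecm-mathlib, FLOOR 0, crux item H413 = stmt-HodgeConjecture-24833; brief B1′ of the P3 integrator (F0P3-plan (g0)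
2026-08-31T00:17:32Z; ENGINE-INTERFACES §7k/§7l), author F0P3-p01 (g3).  PROOF lane (no `def`, no instance, no named fact).

SETTING.  The CM frame `(L, ι, H, T, hT)` of ★ `UnitaryGroupCohomologicalForms` §5: `𝒢 = adelicGroupData L⁺ L c̄ 3 H`, the
archimedean section `cmArchSection : U21 →* U(H)(𝔸_{L⁺})` and compact factor `cmCompactFactor`; an automorphic measure `μ` on the
COMPACT automorphic quotient; a discrete automorphic representation `P`.  The archimedean `(𝔤, K)`-module of `P` is ★
`P.archModuleCM ι T hT` with actions `(P.archRepKCM ι T hT, P.archRepLieCM ι T hT)` of `K = U(2) × U(1)` and `𝔲(2,1)_{Fin 2 ⊕ Fin 1}`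
(★ `DiscreteAutomorphicRepArchModuleCM`).

§1–§3 are GENERIC in a `ℂ²`-valued function `Ψ` on `U(H)(𝔸_{L⁺})` whose coordinates lie in an `L²`-LIE-STABLE space `W` (★
`IsL2LieStable`) for the local archimedean datum `(u21Group, cmArchSection)` — so that the holomorphic case (§4, `W = S(Φ)` of ★
`F0P3CotangentFormL2Span`) and the antiholomorphic twin (sequel file, `W = S(Φ̄)`) are two instances:
* §1 bookkeeping from `W`: `L²` descents, left invariance, the class map, injectivity (`memLp_toQuotFun_of_mem`, …);
* §2 **`toLp_mem_archModuleCM_of`: `[Ψⱼ] ∈ P.archModuleCM ι T hT`** when the classes lie in `P` and `Ψ` has a `K`-TYPE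
  `Ψ (x · ι_∞ k) j = ∑ᵢ M(k) j i · Ψ x i` — SMOOTH VECTOR by ★ `F0P3OrbitSmoothVectors.mem_smoothVectors_of_forall_hasDerivAt` on the
  classes of `W` (directional `L²`-derivatives `d/dt R(exp tY)[ψ] = [Y♭ ψ]`, ★ `hasDerivAt_rightRegular_cl_uForm`), `K`-FINITE by the
  `K`-type (★ `rightRegular_toLp_eq_sum_of_apply_mul`);
* §3 the actions on the classes: **`coe_archRepLieCM_eq_toLp_lieDeriv_of`** (`𝔲(2,1)` acts by the class of the Lie derivative along
  the reindexed element — ★ `hasDerivAt_archRepLie` against the `L²`-derivative, uniqueness), **`archRepLieCM_upqUnit_I_mul_of`**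
  (a pointwise Cauchy–Riemann relation `X_{ib} Ψⱼ = c · X_b Ψⱼ` passes to the classes), **`archRepKCM_eq_sum_of`** (the `K`-type passes
  to the classes);
* §4 THE HOLOMORPHIC CASE `Φ ∈ holCotForms`: `exists_vectors` (the classes as elements of the module) and HEAD **`valueMap_hol`**: for
  the classes `vⱼ = [Φⱼ]` and the real-linear value map `φ(Y) = ∑ⱼ Y_{(inl j)(inr 0)} • vⱼ` (★ `exists_valueMap` with `χ = id`) the five
  binders (h0)(hK)(h𝔨)(hwt)(hN) of a typed null value map OF TYPE `+1` for `(P.archRepKCM, P.archRepLieCM)` hold — token for token those of ★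
  `F0P3ValueMapTransport.not_both_types_of_detected` — and `Φ ≠ 0 → φ ≠ 0` (cotangent `K`-type ★ `apply_mul_cmArchSectionUForm_K`,
  Cauchy–Riemann ★ `IsHolGerm`, algebra ★ `F0P3ValueMapOfFrameVectors.valueMap_hol`).  With ★ S0∕S2 and F1a this is E2′₀(P) ∕ the
  (E)h-arch input WITHOUT any Cayley transport of cocycles (ENGINE-INTERFACES §7l).

References: Borel–Jacquet 1979, §4.1–4.6 [BorelJacquetCorvallis1979]; Borel–Wallach 2000, Ch. 0 §2.4, II §4.1–4.2, VI 4.7–4.8,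
VII 2.10 [BorelWallach2000]; Harish-Chandra 1953, §7, §9 [HarishChandra1953]; Borel 1997, §5.14 [Borel1997]; Rogawski 1990,
Prop. 15.2.1 (b) [Rogawski1990].
HONEST LABEL: HC_CM is proved only modulo the printed citations until rung 0 closes; this file discharges none of them.
-/

-- Mathlib idiom (as in ★ `GKModules` and every `(𝔤, K)` file of the tree): commutator bracket on `Module.End` / matrices
attribute [local instance 100] LieRing.ofAssociativeRing

-- The scoped `L^∞`-operator normed structure on matrices agrees with the product topology only up to non-reducible
-- unfolding (cf. `Matrix.exp_add_of_commute` in Mathlib and ★ `GKModulesSmoothVectorsProofs`).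
set_option backward.isDefEq.respectTransparency false

set_option autoImplicit false
set_option linter.dupNamespace false

noncomputable section

open scoped Matrix MatrixGroups ComplexConjugate ENNReal
open NumberField MeasureTheory MulAction

namespace Summit.HodgeConjecture.HodgeConjecture.Cruxes.H413.F0P3CotangentFormValueMap

open Literature.NumberTheory.Automorphic Literature.NumberTheory.Automorphic.UnitaryGroup
open Literature.NumberTheory.Automorphic.UnitaryGroup.CotangentForms
open Literature.RepresentationTheory.KonnoKonno2007 Literature.RepresentationTheory.KonnoKonno2007.RealDualPair
open Literature.RepresentationTheory.BorelWallach2000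
open Literature.Geometry.ComplexHyperbolic.BallModel (U21 J)
open Literature.AlgebraicGeometry.ShimuraVarieties.BallForms (u21Group liePMat)
open Summit.HodgeConjecture.HodgeConjecture.Cruxes.H413.F0P2aL2cOrderedProducts
open Summit.HodgeConjecture.HodgeConjecture.Cruxes.H413.F0P2aL2bHolLieSpanPackage
open Summit.HodgeConjecture.HodgeConjecture.Cruxes.H413.F0P3OrbitSmoothVectors
open Summit.HodgeConjecture.HodgeConjecture.Cruxes.H413.F0P3CMFrameOrbit
open Summit.HodgeConjecture.HodgeConjecture.Cruxes.H413.F0P3ValueMapOfFrameVectors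
open Summit.HodgeConjecture.HodgeConjecture.Cruxes.H413.F0P3CotangentFormL2Span

variable {L : Type} [Field L] [NumberField L] [IsCMField L] (ι : L →+* ℂ) {H : Matrix (Fin 3) (Fin 3) L}
  (T : GL (Fin 3) ℂ) (hT : (T : Matrix (Fin 3) (Fin 3) ℂ)ᴴ * H.map ι * (T : Matrix (Fin 3) (Fin 3) ℂ) = J)
  {μ : Measure (adelicGroupData (↥(maximalRealSubfield L)) L (IsCMField.complexConj L) 3 H).automorphicQuotient}
  {W : Submodule ℂ ((adelicGroupData (↥(maximalRealSubfield L)) L (IsCMField.complexConj L) 3 H).Adelic → ℂ)}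
  (hW : IsL2LieStable
    ({ arch := u21Group, ofArch := cmArchSection L ι H T hT, continuous_ofArch := continuous_archSectionU21CM L ι H T hT,
           finiteAdelic := ⊥,
           commute_ofArch := fun g h hh => by rw [Subgroup.mem_bot] at hh; rw [hh, mul_one, one_mul],
           finiteLevels := {⊥}, finiteLevels_nonempty := Set.singleton_nonempty ⊥,
           le_finiteAdelic := fun U hU => le_of_eq (Set.mem_singleton_iff.1 hU), height := fun _ => 0 } :
          AutomorphyDatum (adelicGroupData (↥(maximalRealSubfield L)) L (IsCMField.complexConj L) 3 H) ℂ (Fin 3)) μ W)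

/-! ## §1 Bookkeeping from an `L²`-Lie-stable space `W` for the datum `(u21Group, cmArchSection)` -/

include hW in
/-- An element of `W` is LEFT-INVARIANT under `A_G · U(H)(L⁺)` (it is `invQuot` of an `L²` function). [cite: BorelJacquetCorvallis1979, §4.2] -/
theorem leftInvariant_of_mem {ψ : (adelicGroupData (↥(maximalRealSubfield L)) L (IsCMField.complexConj L) 3 H).Adelic → ℂ} (hψ : ψ ∈ W) : ∀ γ ∈ (adelicGroupData (↥(maximalRealSubfield L)) L (IsCMField.complexConj L) 3 H).quotientSubgroup, ∀ g, ψ (γ * g) = ψ g := by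
  obtain ⟨f, -, hf⟩ := hW.le_l2Representable hψ
  intro γ hγ g
  rw [← hf, invQuot_mul_left (adelicGroupData (↥(maximalRealSubfield L)) L (IsCMField.complexConj L) 3 H) f hγ g]

include hW in
/-- An element of `W` has an `L²` DESCENT `toQuotFun ψ`. [cite: BorelJacquetCorvallis1979, §4.6] -/
theorem memLp_toQuotFun_of_mem {ψ : (adelicGroupData (↥(maximalRealSubfield L)) L (IsCMField.complexConj L) 3 H).Adelic → ℂ} (hψ : ψ ∈ W) : MemLp (toQuotFun (adelicGroupData (↥(maximalRealSubfield L)) L (IsCMField.complexConj L) 3 H) ψ) 2 μ := by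
  obtain ⟨f, hf, hfψ⟩ := hW.le_l2Representable hψ
  rwa [eq_toQuotFun_of_invQuot_eq hfψ] at hf

/-- The CLASS MAP of `W` on an element is the class of its descent. [cite: BorelJacquetCorvallis1979, §4.6] -/
theorem cl_eq_toLp_of_mem {ψ : (adelicGroupData (↥(maximalRealSubfield L)) L (IsCMField.complexConj L) 3 H).Adelic → ℂ} (hψ : ψ ∈ W) :
    hW.cl ⟨ψ, hψ⟩ = (memLp_toQuotFun_of_mem ι T hT hW hψ).toLp (toQuotFun (adelicGroupData (↥(maximalRealSubfield L)) L (IsCMField.complexConj L) 3 H) ψ) :=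
  hW.cl_eq_toLp _ (invQuot_toQuotFun (leftInvariant_of_mem ι T hT hW hψ))

/-- **Injectivity of the class map on `W`**: `[ψ] = 0 ↔ ψ = 0`. [cite: BorelJacquetCorvallis1979, §4.6] -/
theorem toLp_eq_zero_iff_of_mem {ψ : (adelicGroupData (↥(maximalRealSubfield L)) L (IsCMField.complexConj L) 3 H).Adelic → ℂ} (hψ : ψ ∈ W) :
    (memLp_toQuotFun_of_mem ι T hT hW hψ).toLp (toQuotFun (adelicGroupData (↥(maximalRealSubfield L)) L (IsCMField.complexConj L) 3 H) ψ) = 0 ↔ ψ = 0 := by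
  refine ⟨fun h0 => ?_, fun h0 => ?_⟩
  · have h := hW.cl_injective (a₁ := ⟨ψ, hψ⟩) (a₂ := 0) (by rw [cl_eq_toLp_of_mem ι T hT hW hψ, h0, map_zero])
    exact congrArg Subtype.val h
  · subst h0
    have e : toQuotFun (adelicGroupData (↥(maximalRealSubfield L)) L (IsCMField.complexConj L) 3 H) (0 : (adelicGroupData (↥(maximalRealSubfield L)) L (IsCMField.complexConj L) 3 H).Adelic → ℂ) = (0 : (adelicGroupData (↥(maximalRealSubfield L)) L (IsCMField.complexConj L) 3 H).automorphicQuotient → ℂ) := rfl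
    have h1 : (memLp_toQuotFun_of_mem ι T hT hW hψ).toLp _ =
        (MemLp.zero : MemLp (0 : (adelicGroupData (↥(maximalRealSubfield L)) L (IsCMField.complexConj L) 3 H).automorphicQuotient → ℂ) 2 μ).toLp 0 :=
      MemLp.toLp_congr _ _ (Filter.EventuallyEq.of_eq e)
    rw [h1]
    exact MemLp.toLp_zero _

/-! ## §2 Classes with a `K`-type lying in `P` are smooth `K`-finite vectors -/

variable [(adelicGroupData (↥(maximalRealSubfield L)) L (IsCMField.complexConj L) 3 H).IsAutomorphicMeasure μ]
  (P : DiscreteAutomorphicRep (adelicGroupData (↥(maximalRealSubfield L)) L (IsCMField.complexConj L) 3 H) μ) {Ψ : (adelicGroupData (↥(maximalRealSubfield L)) L (IsCMField.complexConj L) 3 H).Adelic → (Fin 2 → ℂ)}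

set_option maxHeartbeats 400000 in
/-- **`[Ψⱼ] ∈ P.archModuleCM ι T hT`** for a `ℂ²`-valued `Ψ` with coordinates in the `L²`-Lie-stable space `W`, of `K`-type
`Ψ (x · ι_∞ k) j = ∑ᵢ M(k) j i · Ψ x i` along `cmArchSectionUForm`, whose coordinate classes lie in `P`: a SMOOTH (★
`mem_smoothVectors_of_forall_hasDerivAt` on the classes of `W`, ★ `hasDerivAt_rightRegular_cl_uForm`) and `K`-FINITE (★
`rightRegular_toLp_eq_sum_of_apply_mul`) vector of `P|_{U(2,1)}`. [cite: BorelWallach2000, Ch. 0 §2.4 (p. 3)]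
[cite: HarishChandra1953, §9 (p. 225)] [cite: BorelJacquetCorvallis1979, §4.3 and §4.6] -/
theorem toLp_mem_archModuleCM_of (hWΨ : ∀ j : Fin 2, (fun x => Ψ x j) ∈ W)
    (M : (uFormGroup (Fin 2) (Fin 1)).maximalCompact → Matrix (Fin 2) (Fin 2) ℂ)
    (hrel : ∀ (k : (uFormGroup (Fin 2) (Fin 1)).maximalCompact) (x : (adelicGroupData (↥(maximalRealSubfield L)) L (IsCMField.complexConj L) 3 H).Adelic) (j : Fin 2),
      Ψ (x * cmArchSectionUForm L ι H T hT (Subgroup.inclusion (uFormGroup (Fin 2) (Fin 1)).maximalCompact_le_carrier k)) j =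
        ∑ i : Fin 2, M k j i * Ψ x i)
    (hP : ∀ j : Fin 2, (memLp_toQuotFun_of_mem ι T hT hW (hWΨ j)).toLp _ ∈ P.space.toSubmodule) (j : Fin 2) :
    (⟨(memLp_toQuotFun_of_mem ι T hT hW (hWΨ j)).toLp _, hP j⟩ : P.space.toSubmodule) ∈ P.archModuleCM ι T hT := by
  classical
  obtain ⟨ρ, hρ⟩ := exists_lieHom_lieDeriv_u21 (adelicGroupData (↥(maximalRealSubfield L)) L (IsCMField.complexConj L) 3 H) (cmArchSection L ι H T hT) (continuous_archSectionU21CM L ι H T hT) W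
    (fun ψ hψ => (hW.smooth ψ hψ : IsArchSmooth (H := u21Group) (cmArchSection L ι H T hT) ψ))
    (fun X ψ hψ => (hW.lie_mem X ψ hψ : lieDeriv (H := u21Group) (cmArchSection L ι H T hT) X ψ ∈ W))
  obtain ⟨r, -, hr, -, -⟩ := exists_lieHom_reindex
  have hleft : ∀ γ ∈ (adelicGroupData (↥(maximalRealSubfield L)) L (IsCMField.complexConj L) 3 H).quotientSubgroup, ∀ g, Ψ (γ * g) = Ψ g :=
    fun γ hγ g => funext fun j' => leftInvariant_of_mem ι T hT hW (hWΨ j') γ hγ g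
  have hcl : hW.cl ⟨fun x => Ψ x j, hWΨ j⟩ = (memLp_toQuotFun_of_mem ι T hT hW (hWΨ j)).toLp _ :=
    cl_eq_toLp_of_mem ι T hT hW (hWΨ j)
  rw [DiscreteAutomorphicRep.mem_archModule_iff]
  refine ⟨?_, ?_⟩
  · -- smooth vector: the criterion on the set of classes of `W`
    have hπc : (((adelicGroupData (↥(maximalRealSubfield L)) L (IsCMField.complexConj L) 3 H).rightRegular μ).restrict (cmArchSectionUForm L ι H T hT)).IsStronglyContinuous := fun v =>
      (((adelicGroupData (↥(maximalRealSubfield L)) L (IsCMField.complexConj L) 3 H).isStronglyContinuous_rightRegular_holds μ) v).comp (continuous_cmArchSectionUForm L ι H T hT)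
    -- the directional derivative maps `Y ↦ [ (rY) ψ ]`, real-linear in `Y`
    have hD : ∀ ψ : W, ∃ D : (uFormGroup (Fin 2) (Fin 1)).lie →ₗ[ℝ] (adelicGroupData (↥(maximalRealSubfield L)) L (IsCMField.complexConj L) 3 H).L2 μ,
        ∀ Y : (uFormGroup (Fin 2) (Fin 1)).lie, D Y = hW.cl (ρ (r Y) ψ) := fun ψ =>
      ⟨{ toFun := fun Y => hW.cl (ρ (r Y) ψ)
         map_add' := fun Y Z => by rw [map_add, map_add, LinearMap.add_apply, map_add]
         map_smul' := fun t Y => by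
           rw [map_smul, map_smul, LinearMap.smul_apply, LinearMap.map_smul_of_tower, RingHom.id_apply] }, fun Y => rfl⟩
    choose D hDapply using hD
    have hsm : ∀ v ∈ Set.range hW.cl,
        v ∈ smoothVectors (uFormGroup (Fin 2) (Fin 1)) (((adelicGroupData (↥(maximalRealSubfield L)) L (IsCMField.complexConj L) 3 H).rightRegular μ).restrict (cmArchSectionUForm L ι H T hT)) := by
      intro v hv
      refine mem_smoothVectors_of_forall_hasDerivAt (uFormGroup (Fin 2) (Fin 1)) _ hπc (S := Set.range hW.cl)
        (fun w => if h : ∃ ψ : W, hW.cl ψ = w then D h.choose else 0) (fun w hw X => ?_) (fun w hw X => ?_) hv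
      · obtain ⟨ψ, rfl⟩ := hw
        have hex : ∃ ψ' : W, hW.cl ψ' = hW.cl ψ := ⟨ψ, rfl⟩
        rw [dif_pos hex, hDapply, hW.cl_injective hex.choose_spec]
        exact hasDerivAt_rightRegular_cl_uForm ι T hT hW ρ hρ X (r X) (hr X) ψ
      · obtain ⟨ψ, rfl⟩ := hw
        have hex : ∃ ψ' : W, hW.cl ψ' = hW.cl ψ := ⟨ψ, rfl⟩
        rw [dif_pos hex, hDapply]
        exact ⟨_, rfl⟩
    have hv : (memLp_toQuotFun_of_mem ι T hT hW (hWΨ j)).toLp _ ∈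
        smoothVectors (uFormGroup (Fin 2) (Fin 1)) (((adelicGroupData (↥(maximalRealSubfield L)) L (IsCMField.complexConj L) 3 H).rightRegular μ).restrict (cmArchSectionUForm L ι H T hT)) :=
      hsm _ ⟨_, hcl⟩
    rw [DiscreteAutomorphicRep.mem_smoothVectors_archRep_iff]
    exact (mem_smoothVectors_iff (uFormGroup (Fin 2) (Fin 1)) _ _).1 hv
  · -- `K`-finite: the `K`-translates of `[Ψⱼ]` lie in the span of `[Ψ₀], [Ψ₁]`
    rw [DiscreteAutomorphicRep.mem_kFiniteVectors_archRep_iff]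
    have hle : Submodule.span ℂ (Set.range fun k : (uFormGroup (Fin 2) (Fin 1)).maximalCompact =>
        (adelicGroupData (↥(maximalRealSubfield L)) L (IsCMField.complexConj L) 3 H).rightRegular μ (cmArchSectionUForm L ι H T hT (Subgroup.inclusion (uFormGroup (Fin 2) (Fin 1)).maximalCompact_le_carrier k))
          ((memLp_toQuotFun_of_mem ι T hT hW (hWΨ j)).toLp _)) ≤
        Submodule.span ℂ (Set.range fun i : Fin 2 => (memLp_toQuotFun_of_mem ι T hT hW (hWΨ i)).toLp
          (toQuotFun (adelicGroupData (↥(maximalRealSubfield L)) L (IsCMField.complexConj L) 3 H) fun x => Ψ x i)) := by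
      refine Submodule.span_le.2 ?_
      rintro _ ⟨k, rfl⟩
      dsimp only
      rw [F0P3ProjectionPreservesType.rightRegular_toLp_eq_sum_of_apply_mul hleft (fun x j' => hrel k x j')
        (fun i => memLp_toQuotFun_of_mem ι T hT hW (hWΨ i)) j]
      exact Submodule.sum_mem _ fun i _ => Submodule.smul_mem _ _ (Submodule.subset_span ⟨i, rfl⟩)
    haveI : FiniteDimensional ℂ (Submodule.span ℂ (Set.range fun i : Fin 2 =>
        (memLp_toQuotFun_of_mem ι T hT hW (hWΨ i)).toLp (toQuotFun (adelicGroupData (↥(maximalRealSubfield L)) L (IsCMField.complexConj L) 3 H) fun x => Ψ x i))) :=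
      FiniteDimensional.span_of_finite ℂ (Set.finite_range _)
    exact Submodule.finiteDimensional_of_le hle

/-! ## §3 The actions of `𝔲(2,1)` and `K` on the classes -/

/-- **`𝔲(2,1)` acts on a class of `W` by the class of the Lie derivative**: for `v ∈ P.archModuleCM ι T hT` with `v = [Ψⱼ]` in `L²`,
`Ψⱼ ∈ W`, and `Y ∈ 𝔲(2,1)_{Fin 2 ⊕ Fin 1}` with reindexed copy `Y♭`, `ρ𝔤(Y) v = [Y♭ Ψⱼ]` in `L²` (★ `hasDerivAt_archRepLie` against ★
`hasDerivAt_rightRegular_cl_uForm`, uniqueness of the `L²`-derivative). [cite: HarishChandra1953, §7 (p. 209) and §9]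
[cite: BorelWallach2000, Ch. 0 §2.4 (p. 3)] -/
theorem coe_archRepLieCM_eq_toLp_lieDeriv_of (hWΨ : ∀ j : Fin 2, (fun x => Ψ x j) ∈ W) {v : P.archModuleCM ι T hT} {j : Fin 2}
    (hv : ((v : P.space.toSubmodule) : (adelicGroupData (↥(maximalRealSubfield L)) L (IsCMField.complexConj L) 3 H).L2 μ) = (memLp_toQuotFun_of_mem ι T hT hW (hWΨ j)).toLp _)
    (Y : (uFormGroup (Fin 2) (Fin 1)).lie) (Y' : u21Group.lie)
    (hY : (Y' : Matrix (Fin 3) (Fin 3) ℂ) = Matrix.reindex (finSumFinEquiv : Fin 2 ⊕ Fin 1 ≃ Fin 3) finSumFinEquiv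
      (Y : Matrix (Fin 2 ⊕ Fin 1) (Fin 2 ⊕ Fin 1) ℂ)) :
    (((P.archRepLieCM ι T hT Y v : P.archModuleCM ι T hT) : P.space.toSubmodule) : (adelicGroupData (↥(maximalRealSubfield L)) L (IsCMField.complexConj L) 3 H).L2 μ) =
      (memLp_toQuotFun_of_mem ι T hT hW (hW.lie_mem Y' _ (hWΨ j))).toLp
        (toQuotFun (adelicGroupData (↥(maximalRealSubfield L)) L (IsCMField.complexConj L) 3 H) (lieDeriv (H := u21Group) (cmArchSection L ι H T hT) Y' fun x => Ψ x j)) := by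
  obtain ⟨ρ, hρ⟩ := exists_lieHom_lieDeriv_u21 (adelicGroupData (↥(maximalRealSubfield L)) L (IsCMField.complexConj L) 3 H) (cmArchSection L ι H T hT) (continuous_archSectionU21CM L ι H T hT) W
    (fun ψ hψ => (hW.smooth ψ hψ : IsArchSmooth (H := u21Group) (cmArchSection L ι H T hT) ψ))
    (fun X ψ hψ => (hW.lie_mem X ψ hψ : lieDeriv (H := u21Group) (cmArchSection L ι H T hT) X ψ ∈ W))
  have hcl : hW.cl ⟨fun x => Ψ x j, hWΨ j⟩ = (memLp_toQuotFun_of_mem ι T hT hW (hWΨ j)).toLp _ :=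
    cl_eq_toLp_of_mem ι T hT hW (hWΨ j)
  have hcl' : hW.cl (ρ Y' ⟨fun x => Ψ x j, hWΨ j⟩) =
      (memLp_toQuotFun_of_mem ι T hT hW (hW.lie_mem Y' _ (hWΨ j))).toLp _ := by
    have e : ρ Y' ⟨fun x => Ψ x j, hWΨ j⟩ = ⟨_, hW.lie_mem Y' _ (hWΨ j)⟩ := Subtype.ext (hρ Y' _)
    rw [e]
    exact cl_eq_toLp_of_mem ι T hT hW _
  -- the `L²`-derivative of the orbit of `[Ψⱼ]` along `exp (tY)` in the `Fin 2 ⊕ Fin 1` frame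
  have hd := hasDerivAt_rightRegular_cl_uForm ι T hT hW ρ hρ Y Y' hY ⟨fun x => Ψ x j, hWΨ j⟩
  rw [hcl, hcl'] at hd
  -- the same orbit, differentiated inside `P.space` by ★ `hasDerivAt_archRepLie`, pushed to `L²`
  have hd2 := ((P.space.toSubmodule.subtypeL.restrictScalars ℝ).hasFDerivAt).comp_hasDerivAt (0 : ℝ)
    (P.hasDerivAt_archRepLie (uFormGroup (Fin 2) (Fin 1)) (cmArchSectionUForm L ι H T hT)
      (continuous_cmArchSectionUForm L ι H T hT) Y v)
  have hfun : ((P.space.toSubmodule.subtypeL.restrictScalars ℝ) ∘ fun t : ℝ =>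
      P.archRep (uFormGroup (Fin 2) (Fin 1)) (cmArchSectionUForm L ι H T hT) ((uFormGroup (Fin 2) (Fin 1)).expMem (t • Y))
        (v : P.space.toSubmodule)) =
      fun t : ℝ => (adelicGroupData (↥(maximalRealSubfield L)) L (IsCMField.complexConj L) 3 H).rightRegular μ (cmArchSectionUForm L ι H T hT ((uFormGroup (Fin 2) (Fin 1)).expMem (t • Y)))
        ((memLp_toQuotFun_of_mem ι T hT hW (hWΨ j)).toLp _) := by
    funext t
    rw [Function.comp_apply, ContinuousLinearMap.coe_restrictScalars', Submodule.subtypeL_apply,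
      DiscreteAutomorphicRep.coe_archRep_apply, hv]
  have hd' := hd.congr_of_eventuallyEq (Filter.EventuallyEq.of_eq hfun)
  -- `(subtypeL.restrictScalars ℝ) x = ↑x` definitionally: no rewriting (it is costly here), just `exact`
  exact hd2.unique hd'

/-- **A pointwise Cauchy–Riemann relation passes to the classes**: if `X_{ib} Ψⱼ = c · X_b Ψⱼ` pointwise for all `b ∈ ℂ²` then
`ρ𝔤(X_{ic'E_p}) v = c • ρ𝔤(X_{c'E_p}) v` for `v = [Ψⱼ]` (`c = i`: holomorphic; `c = −i`: antiholomorphic; ★ `reindexed_upqUnit`).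
[cite: Borel1997, §5.14] [cite: BorelWallach2000, II §4.1] -/
theorem archRepLieCM_upqUnit_I_mul_of (hWΨ : ∀ j : Fin 2, (fun x => Ψ x j) ∈ W) (c : ℂ)
    (hCR : ∀ (b : Fin 2 → ℂ) (j : Fin 2) (x : (adelicGroupData (↥(maximalRealSubfield L)) L (IsCMField.complexConj L) 3 H).Adelic),
      lieDeriv (H := u21Group) (cmArchSection L ι H T hT) (liePMat (Complex.I • b)) (fun y => Ψ y j) x =
        c * lieDeriv (H := u21Group) (cmArchSection L ι H T hT) (liePMat b) (fun y => Ψ y j) x)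
    {v : P.archModuleCM ι T hT} {j : Fin 2}
    (hv : ((v : P.space.toSubmodule) : (adelicGroupData (↥(maximalRealSubfield L)) L (IsCMField.complexConj L) 3 H).L2 μ) = (memLp_toQuotFun_of_mem ι T hT hW (hWΨ j)).toLp _)
    (p : Fin 2 × Fin 1) (c' : ℂ) :
    P.archRepLieCM ι T hT (upqUnit p (Complex.I * c')) v = c • P.archRepLieCM ι T hT (upqUnit p c') v := by
  apply Subtype.ext
  apply Subtype.ext
  rw [coe_archRepLieCM_eq_toLp_lieDeriv_of ι T hT hW P hWΨ hv (upqUnit p (Complex.I * c')) (liePMat (Pi.single p.1 (Complex.I * c')))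
      (reindexed_upqUnit p _), Submodule.coe_smul, Submodule.coe_smul,
    coe_archRepLieCM_eq_toLp_lieDeriv_of ι T hT hW P hWΨ hv (upqUnit p c') (liePMat (Pi.single p.1 c')) (reindexed_upqUnit p c'),
    ← MemLp.toLp_const_smul]
  refine MemLp.toLp_congr _ _ (Filter.EventuallyEq.of_eq ?_)
  funext y
  simp only [toQuotFun, Pi.smul_apply, smul_eq_mul]
  rw [single_I_mul, hCR]

/-- **A `K`-type passes to the classes**: `ρK(k) [Ψⱼ] = ∑ᵢ M(k) j i • [Ψᵢ]` in `P.archModuleCM ι T hT` (★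
`rightRegular_toLp_eq_sum_of_apply_mul`). [cite: BorelWallach2000, VI 4.8] [cite: BorelJacquetCorvallis1979, §4.6] -/
theorem archRepKCM_eq_sum_of (hWΨ : ∀ j : Fin 2, (fun x => Ψ x j) ∈ W)
    (M : (uFormGroup (Fin 2) (Fin 1)).maximalCompact → Matrix (Fin 2) (Fin 2) ℂ)
    (hrel : ∀ (k : (uFormGroup (Fin 2) (Fin 1)).maximalCompact) (x : (adelicGroupData (↥(maximalRealSubfield L)) L (IsCMField.complexConj L) 3 H).Adelic) (j : Fin 2),
      Ψ (x * cmArchSectionUForm L ι H T hT (Subgroup.inclusion (uFormGroup (Fin 2) (Fin 1)).maximalCompact_le_carrier k)) j =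
        ∑ i : Fin 2, M k j i * Ψ x i)
    (v : Fin 2 → P.archModuleCM ι T hT)
    (hv : ∀ j : Fin 2, ((v j : P.space.toSubmodule) : (adelicGroupData (↥(maximalRealSubfield L)) L (IsCMField.complexConj L) 3 H).L2 μ) = (memLp_toQuotFun_of_mem ι T hT hW (hWΨ j)).toLp _)
    (k : (uFormGroup (Fin 2) (Fin 1)).maximalCompact) (j : Fin 2) :
    P.archRepKCM ι T hT k (v j) = ∑ i : Fin 2, M k j i • v i := by
  have hleft : ∀ γ ∈ (adelicGroupData (↥(maximalRealSubfield L)) L (IsCMField.complexConj L) 3 H).quotientSubgroup, ∀ g, Ψ (γ * g) = Ψ g :=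
    fun γ hγ g => funext fun j' => leftInvariant_of_mem ι T hT hW (hWΨ j') γ hγ g
  apply Subtype.ext
  apply Subtype.ext
  rw [DiscreteAutomorphicRep.coe_archRepK_apply, DiscreteAutomorphicRep.coe_archRep_apply, hv j,
    F0P3ProjectionPreservesType.rightRegular_toLp_eq_sum_of_apply_mul hleft (fun x j' => hrel k x j')
      (fun i => memLp_toQuotFun_of_mem ι T hT hW (hWΨ i)) j,
    Submodule.coe_sum, Submodule.coe_sum]
  refine Finset.sum_congr rfl fun i _ => ?_
  rw [Submodule.coe_smul, Submodule.coe_smul, hv i]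

/-- The coordinate classes as elements of the archimedean module (★ `toLp_mem_archModuleCM_of`).
[cite: BorelWallach2000, Ch. 0 §2.4 (p. 3)] -/
theorem exists_vectors_of (hWΨ : ∀ j : Fin 2, (fun x => Ψ x j) ∈ W)
    (M : (uFormGroup (Fin 2) (Fin 1)).maximalCompact → Matrix (Fin 2) (Fin 2) ℂ)
    (hrel : ∀ (k : (uFormGroup (Fin 2) (Fin 1)).maximalCompact) (x : (adelicGroupData (↥(maximalRealSubfield L)) L (IsCMField.complexConj L) 3 H).Adelic) (j : Fin 2),
      Ψ (x * cmArchSectionUForm L ι H T hT (Subgroup.inclusion (uFormGroup (Fin 2) (Fin 1)).maximalCompact_le_carrier k)) j =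
        ∑ i : Fin 2, M k j i * Ψ x i)
    (hP : ∀ j : Fin 2, (memLp_toQuotFun_of_mem ι T hT hW (hWΨ j)).toLp _ ∈ P.space.toSubmodule) :
    ∃ v : Fin 2 → P.archModuleCM ι T hT,
      ∀ j : Fin 2, (((v j : P.archModuleCM ι T hT) : P.space.toSubmodule) : (adelicGroupData (↥(maximalRealSubfield L)) L (IsCMField.complexConj L) 3 H).L2 μ) =
        (memLp_toQuotFun_of_mem ι T hT hW (hWΨ j)).toLp (toQuotFun (adelicGroupData (↥(maximalRealSubfield L)) L (IsCMField.complexConj L) 3 H) fun x => Ψ x j) := by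
  have hmem := toLp_mem_archModuleCM_of ι T hT hW P hWΨ M hrel hP
  refine ⟨fun j => ⟨⟨_, hP j⟩, hmem j⟩, fun j => ?_⟩
  rfl

/-! ## §4 The holomorphic case: `W = S(Φ)`, cotangent `K`-type, Cauchy–Riemann with `c = i` -/

section Hol

variable [CompactSpace (adelicGroupData (↥(maximalRealSubfield L)) L (IsCMField.complexConj L) 3 H).automorphicQuotient] {Φ : (adelicGroupData (↥(maximalRealSubfield L)) L (IsCMField.complexConj L) 3 H).Adelic → (Fin 2 → ℂ)}

omit hW [CompactSpace (adelicGroupData (↥(maximalRealSubfield L)) L (IsCMField.complexConj L) 3 H).automorphicQuotient] in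
/-- **Cauchy–Riemann along `𝔭` for the coordinates of a holomorphic cotangent form**: `X_{ib} Φⱼ = i · X_b Φⱼ` pointwise (★ `IsHolGerm`
through ★ `lieDeriv_liePMat_eq_fderiv_germAt`). [cite: Borel1997, §5.14] -/
theorem lieDeriv_liePMat_I_smul_hol
    (hΦ : Φ ∈ holCotForms (↥(maximalRealSubfield L)) L (IsCMField.complexConj L) 3 H (cmArchSection L ι H T hT)
      (cmCompactFactor L ι H T hT)) (b : Fin 2 → ℂ) (j : Fin 2) (x : (adelicGroupData (↥(maximalRealSubfield L)) L (IsCMField.complexConj L) 3 H).Adelic) :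
    lieDeriv (H := u21Group) (cmArchSection L ι H T hT) (liePMat (Complex.I • b)) (fun y => Φ y j) x =
      Complex.I * lieDeriv (H := u21Group) (cmArchSection L ι H T hT) (liePMat b) (fun y => Φ y j) x := by
  obtain ⟨-, -, -, hH⟩ := mem_holCotForms_iff.1 hΦ
  rw [F0P3HolProjectionReduction.lieDeriv_liePMat_eq_fderiv_germAt (cmArchSection L ι H T hT) (hH.1 x),
    F0P3HolProjectionReduction.lieDeriv_liePMat_eq_fderiv_germAt (cmArchSection L ι H T hT) (hH.1 x), hH.2 x b, Pi.smul_apply,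
    smul_eq_mul]

omit hW in
/-- The two coordinate classes of a holomorphic cotangent form `Φ` with classes in `P`, as elements of `P.archModuleCM ι T hT`
(`W = S(Φ)`, ★ `isL2LieStable_span`; cotangent `K`-type ★ `apply_mul_cmArchSectionUForm_K`). [cite: BorelWallach2000, Ch. 0 §2.4 (p. 3)] -/
theorem exists_vectors
    (hΦ : Φ ∈ holCotForms (↥(maximalRealSubfield L)) L (IsCMField.complexConj L) 3 H (cmArchSection L ι H T hT)
      (cmCompactFactor L ι H T hT))
    (hP : ∀ j : Fin 2, (memLp_toQuotFun_apply ι T hT (μ := μ) hΦ j).toLp _ ∈ P.space.toSubmodule) :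
    ∃ v : Fin 2 → P.archModuleCM ι T hT,
      ∀ j : Fin 2, (((v j : P.archModuleCM ι T hT) : P.space.toSubmodule) : (adelicGroupData (↥(maximalRealSubfield L)) L (IsCMField.complexConj L) 3 H).L2 μ) =
        (memLp_toQuotFun_apply ι T hT (μ := μ) hΦ j).toLp (toQuotFun (adelicGroupData (↥(maximalRealSubfield L)) L (IsCMField.complexConj L) 3 H) fun x => Φ x j) :=
  exists_vectors_of ι T hT (isL2LieStable_span ι T hT (μ := μ) hΦ) P apply_mem_span_iterLieDeriv_hol
    (fun k j i => (starRingEnd ℂ) (((k : GL (Fin 2 ⊕ Fin 1) ℂ) : Matrix (Fin 2 ⊕ Fin 1) (Fin 2 ⊕ Fin 1) ℂ) (Sum.inr 0) (Sum.inr 0)) *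
      ((k : GL (Fin 2 ⊕ Fin 1) ℂ) : Matrix (Fin 2 ⊕ Fin 1) (Fin 2 ⊕ Fin 1) ℂ) (Sum.inl i) (Sum.inl j))
    (fun k x j => apply_mul_cmArchSectionUForm_K L ι H T hT hΦ k x j) hP

omit hW in
/-- **B1′ — THE VALUE MAP OF A HOLOMORPHIC COTANGENT FORM IS A TYPED NULL VALUE MAP OF TYPE `+1`.**  Let `Φ` be a holomorphic
cotangent automorphic form of the CM frame whose coordinate classes lie in the discrete automorphic representation `P` (this is
`P.ContainsForm Φ`), let `v₀, v₁ ∈ P.archModuleCM ι T hT` be those classes (`exists_vectors`) and `φ : 𝔲(2,1)_{Fin 2 ⊕ Fin 1} → P.archModuleCM ι T hT`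
the real-linear value map `φ(Y) = ∑ⱼ Y_{(inl j)(inr 0)} • vⱼ` (★ `F0P3ValueMapOfFrameVectors.exists_valueMap` with `χ = id`; so
`φ(X_{cE_{a,0}}) = c • v_a`, ℂ-linear on `𝔭`).  Then, for `(ρK, ρ𝔤) = (P.archRepKCM ι T hT, P.archRepLieCM ι T hT)`:
(h0) `φ(𝔨) = 0`; (hK) `ρK(k) φ(Y) = φ(Ad(k) Y)`; (h𝔨) `φ(⁅W, Y⁆) = ρ𝔤(W) φ(Y)` for `W ∈ 𝔨`; (hwt) `ρ𝔤(z₀) φ(Y) = i • φ(Y)`;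
(hN) `ρ𝔤(x_s) φ(Y) + i • ρ𝔤(⁅z₀, x_s⁆) φ(Y) = 0` — the binders `hp0 … hpN` of ★ `F0P3ValueMapTransport.not_both_types_of_detected` at
`(α, β) = (Fin 2, Fin 1)`, token for token — and `Φ ≠ 0 → φ ≠ 0`.  (No Cayley transport of cocycles is used: ENGINE-INTERFACES §7l.)
[cite: BorelWallach2000, II §4.1–4.2, VI 4.8 and VII 2.10] [cite: Rogawski1990, Prop. 15.2.1 (b)] [cite: BorelJacquetCorvallis1979, §4.6] -/
theorem valueMap_hol
    (hΦ : Φ ∈ holCotForms (↥(maximalRealSubfield L)) L (IsCMField.complexConj L) 3 H (cmArchSection L ι H T hT)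
      (cmCompactFactor L ι H T hT)) (v : Fin 2 → P.archModuleCM ι T hT)
    (hv : ∀ j : Fin 2, (((v j : P.archModuleCM ι T hT) : P.space.toSubmodule) : (adelicGroupData (↥(maximalRealSubfield L)) L (IsCMField.complexConj L) 3 H).L2 μ) =
      (memLp_toQuotFun_apply ι T hT (μ := μ) hΦ j).toLp (toQuotFun (adelicGroupData (↥(maximalRealSubfield L)) L (IsCMField.complexConj L) 3 H) fun x => Φ x j))
    (φ : (uFormGroup (Fin 2) (Fin 1)).lie →ₗ[ℝ] P.archModuleCM ι T hT)
    (hφ : ∀ Y : (uFormGroup (Fin 2) (Fin 1)).lie,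
      φ Y = ∑ j : Fin 2, ((Y : Matrix (Fin 2 ⊕ Fin 1) (Fin 2 ⊕ Fin 1) ℂ) (Sum.inl j) (Sum.inr 0)) • v j) :
    (∀ W ∈ (uFormGroup (Fin 2) (Fin 1)).kInLie, φ W = 0) ∧
    (∀ (k : (uFormGroup (Fin 2) (Fin 1)).maximalCompact) (X : (uFormGroup (Fin 2) (Fin 1)).lie),
      P.archRepKCM ι T hT k (φ X) = φ ((uFormGroup (Fin 2) (Fin 1)).Ad
        (Subgroup.inclusion (uFormGroup (Fin 2) (Fin 1)).maximalCompact_le_carrier k) X)) ∧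
    (∀ W ∈ (uFormGroup (Fin 2) (Fin 1)).kInLie, ∀ X : (uFormGroup (Fin 2) (Fin 1)).lie,
      φ ⁅W, X⁆ = P.archRepLieCM ι T hT W (φ X)) ∧
    (∀ X : (uFormGroup (Fin 2) (Fin 1)).lie, P.archRepLieCM ι T hT (upqZ0 (Fin 2) (Fin 1)) (φ X) = Complex.I • φ X) ∧
    (∀ (X : (uFormGroup (Fin 2) (Fin 1)).lie) (s : (Fin 2 × Fin 1) × Fin 2),
      P.archRepLieCM ι T hT (upqPBasis s) (φ X) +
        Complex.I • P.archRepLieCM ι T hT ⁅upqZ0 (Fin 2) (Fin 1), upqPBasis s⁆ (φ X) = 0) ∧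
    (Φ ≠ 0 → φ ≠ 0) := by
  have hW' := isL2LieStable_span ι T hT (μ := μ) hΦ
  have hWΦ : ∀ j : Fin 2, (fun x => Φ x j) ∈ Submodule.span ℂ (Set.range fun p : List u21Group.lie × Fin 2 =>
      iterLieDeriv (H := u21Group) (cmArchSection L ι H T hT) p.1 fun x => Φ x p.2) := apply_mem_span_iterLieDeriv_hol
  have h5 := F0P3ValueMapOfFrameVectors.valueMap_hol (P.archRepKCM ι T hT) (P.archRepLieCM ι T hT)
    (P.isGKModule_archModuleCM ι T hT) v
    (archRepKCM_eq_sum_of ι T hT hW' P hWΦ _ (fun k x j => apply_mul_cmArchSectionUForm_K L ι H T hT hΦ k x j) v hv)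
    (fun p c j => archRepLieCM_upqUnit_I_mul_of ι T hT hW' P hWΦ Complex.I (lieDeriv_liePMat_I_smul_hol ι T hT hΦ) (hv j) p c)
    φ hφ
  refine ⟨h5.1, h5.2.1, h5.2.2.1, h5.2.2.2.1, h5.2.2.2.2, fun hΦ0 hφ0 => hΦ0 ?_⟩
  -- nonvanishing: `φ = 0` forces `[Φⱼ] = 0`, hence `Φⱼ = 0`, for both `j`
  have hφ' : ∀ Y : (uFormGroup (Fin 2) (Fin 1)).lie, φ Y = ∑ j : Fin 2,
      LinearMap.id (R := ℝ) ((Y : Matrix (Fin 2 ⊕ Fin 1) (Fin 2 ⊕ Fin 1) ℂ) (Sum.inl j) (Sum.inr 0)) • v j := hφ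
  have hv0 := (valueMap_eq_zero_iff LinearMap.id (by rw [LinearMap.id_apply]; exact one_ne_zero) v φ hφ').1 hφ0
  funext x j
  have hj : (fun x => Φ x j) = 0 := by
    rw [← toLp_eq_zero_iff_of_mem ι T hT hW' (hWΦ j), ← hv j, hv0 j]
    rfl
  exact congrFun hj x

end Hol

end Summit.HodgeConjecture.HodgeConjecture.Cruxes.H413.F0P3CotangentFormValueMap

end
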